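import Summits.AtomisticToContinuum.HydrodynamicLimit.Theorems.RelayRaceLocalityNearConstantShortTimeHLCommutators
import Summits.AtomisticToContinuum.HydrodynamicLimit.Theorems.RelayRaceLocalityNearConstantShortTimeHLFluxIntegrability
import HarnessLib

/-!
# Crux `NearConstantShortTimeHL` (stmt-AtomisticToContinuum-12502), line `small-tilt-domination`, skeleton v14 (lead c7):
# the PER-TERM ESTIMATE of the net reduction `MesoscaleDensityLD ⇐ BallTiltLogLaplace`

Support file (`--supports stmt-AtomisticToContinuum-12502`) for the registered stub `stub_densityLD_of_ballTilt`
(`…DensityLDNetDefs`, blueprint steps 4–5). After Jensen over the torus cells and the quadratic net, the exponential moment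
of the mesoscale density functional is a finite sum, over net assignments `λ : J → {j/m − 2}` and cell selections `(y_j)_j`, of
exponential moments of LINEAR statistics
`γ′ n Σ_j b (λ_j (ρ̃(y_j) − ρ₁(y_j)) − λ_j²/4) = 4γ′ Σᵢ G(xᵢ) + E₀`, `G = Σ_j (b λ_j/4) ballKernel ℓ (y_j) ·`.
`dl_term_le` bounds ONE such term by `exp(n (2γ′ M ℓ + κ′))`, given (as hypotheses, instantiated by the assembly file):
the log-Laplace bound for the ball-average tilts based at `(y_j)` (the instance of `BallTiltLogLaplace`), the Schur `L²`
bound `∫ G² ≤ (Ā/16) Σ_j b λ_j²` (the instance of `integral_sq_sum_ballKernel_le`), the envelope `Σ_j b ballKernel ℓ (y_j) · ≤ Ā ≤ 2`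
(cell counting), `Σ_j b = 1`, `|λ_j| ≤ 2`, and `C₀ γ′ Ā ≤ 1/4`: the centring `n·4γ′∫Gρ₁` cancels `E₀`'s linear part up to the
Lipschitz bias `2γ′ M ℓ n` (`dl_bias`), and the quadratic remainder `C₀ (4γ′)² n ∫G²` is absorbed by the net penalty `−γ′ n Σ b λ²/4`.
Elementary (finite sums, one Bochner integral against the ball kernel).
References: H.-T. Yau, Lett. Math. Phys. 22 (1991) §2 (folklore reduction).
-/

noncomputable section

namespace Summit.AtomisticToContinuum.HydrodynamicLimit.Theorems.NearConstantShortTimeHL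

open scoped BigOperators ENNReal
open MeasureTheory Set Filter Topology
open Literature.MathematicalPhysics.KineticTheory Literature.Analysis.FluidPDE Literature.Analysis.FunctionSpaces

/-! ## The ball kernel: symmetry and the Lipschitz bias of the ball average -/

/-- The ball kernel is symmetric (the minimal-image distance is; registered). [folklore] -/
theorem dl_ballKernel_comm : ∀ (ℓ : ℝ) (x y : T3), ballKernel ℓ x y = ballKernel ℓ y x := by
  intro ℓ x y
  unfold ballKernel
  rw [Torus.euclidDist_comm]

/-- **Lipschitz bias of the ball average**: `|ρ₁(y) − ∫ ballKernel ℓ y x · ρ₁ x dx| ≤ M ℓ` for an `M`-Lipschitz profile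
(`0 < ℓ < 1/2`, the kernel has unit mass and lives on `d(x,y) < ℓ`, where `dist ≤ euclidDist`). [folklore] -/
theorem dl_bias {ℓ : ℝ} (hℓ0 : 0 < ℓ) (hℓ : ℓ < 1 / 2) {ρ₁ : T3 → ℝ} (hρc : Continuous ρ₁) {ML : ℝ} (hML : 0 ≤ ML)
    (hlip : ∀ x y, |ρ₁ x - ρ₁ y| ≤ ML * dist x y) (y : T3) :
    |ρ₁ y - ∫ x, ballKernel ℓ y x * ρ₁ x| ≤ ML * ℓ := by
  have h : (fun x => ballKernel ℓ y x * ρ₁ x) = fun x => ρ₁ x * ballKernel ℓ x y := by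
    funext x; rw [dl_ballKernel_comm, mul_comm]
  rw [h]
  refine abs_sub_integral_mul_ballKernel_le hℓ0 hℓ hρc y fun x hx => ?_
  have hdist : dist y x ≤ ℓ := by
    rw [dist_comm, dist_eq_norm]
    exact (Torus.norm_sub_le_euclidDist_holds x y).trans hx.le
  exact (hlip y x).trans (mul_le_mul_of_nonneg_left hdist hML)

/-! ## Bounded measurable functions against the ball kernels -/

/-- A finite combination of ball kernels is measurable. [folklore] -/
theorem dl_measurable_comb {ℓ : ℝ} {J : Type} [Fintype J] (ys : J → T3) (w : J → ℝ) :
    Measurable fun x : T3 => ∑ j, w j * ballKernel ℓ (ys j) x :=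
  Finset.measurable_sum _ fun _ _ => (wg_measurable_ballKernel measurable_const measurable_id ℓ).const_mul _

/-- `∫ (Σ_j w_j ballKernel ℓ (y_j) x) ρ₁(x) dx = Σ_j w_j ∫ ballKernel ℓ (y_j) x ρ₁(x) dx`. [folklore] -/
theorem dl_integral_comb_mul {ℓ : ℝ} {J : Type} [Fintype J] (ys : J → T3) (w : J → ℝ) {ρ₁ : T3 → ℝ}
    (hρc : Continuous ρ₁) :
    ∫ x, (∑ j, w j * ballKernel ℓ (ys j) x) * ρ₁ x = ∑ j, w j * ∫ x, ballKernel ℓ (ys j) x * ρ₁ x := by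
  have h : (fun x : T3 => (∑ j, w j * ballKernel ℓ (ys j) x) * ρ₁ x) =
      fun x => ∑ j, w j * (ballKernel ℓ (ys j) x * ρ₁ x) := by
    funext x; rw [Finset.sum_mul]; refine Finset.sum_congr rfl fun j _ => ?_; ring
  have hint : ∀ j, Integrable fun x : T3 => ballKernel ℓ (ys j) x * ρ₁ x := by
    intro j
    have e : (fun x : T3 => ballKernel ℓ (ys j) x * ρ₁ x) = fun x => ρ₁ x * ballKernel ℓ x (ys j) := by
      funext x; rw [dl_ballKernel_comm, mul_comm]
    rw [e]; exact integrable_continuous_mul_ballKernel ℓ hρc (ys j)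
  rw [h, integral_finsetSum _ fun j _ => (hint j).const_mul _]
  exact Finset.sum_congr rfl fun j _ => integral_const_mul _ _

/-! ## The per-term estimate -/

/-- **One term of the net sum.** See the module docstring. [cite: Yau1991, §2] -/
theorem dl_term_le {m : ℕ} (hm : 0 < m) {ℓ : ℝ} (hℓ0 : 0 < ℓ) (hℓ : ℓ < 1 / 2) (μ : Measure (Fin m → T3))
    {ρ₁ : T3 → ℝ} (hρc : Continuous ρ₁) {ML : ℝ} (hML : 0 ≤ ML) (hlip : ∀ x y, |ρ₁ x - ρ₁ y| ≤ ML * dist x y)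
    {J : Type} [Fintype J] (ys : J → T3) {b : ℝ} (hb : 0 ≤ b) (hbsum : ∑ _j : J, b = 1)
    {Ā : ℝ} (hĀ : ∀ x, ∑ j, b * ballKernel ℓ (ys j) x ≤ Ā) (hĀ2 : Ā ≤ 2)
    {γ' C₀ κ' : ℝ} (hγ' : 0 < γ') (hγC : C₀ * γ' * Ā ≤ 1 / 4)
    (hSchur : ∀ lam : J → ℝ,
      ∫ x, (∑ j, b / 4 * lam j * ballKernel ℓ (ys j) x) ^ 2 ≤ Ā / 4 * ∑ j, b / 4 * lam j ^ 2)
    (hB : ∀ w : J → ℝ, (∀ x, |∑ j, w j * ballKernel ℓ (ys j) x| ≤ 1) →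
      ∫⁻ x, ENNReal.ofReal (Real.exp ((4 * γ') * ∑ i, ∑ j, w j * ballKernel ℓ (ys j) (x i))) ∂μ ≤
        ENNReal.ofReal (Real.exp ((m : ℝ) * ((4 * γ') * (∫ x, (∑ j, w j * ballKernel ℓ (ys j) x) * ρ₁ x) +
          C₀ * (4 * γ') ^ 2 * (∫ x, (∑ j, w j * ballKernel ℓ (ys j) x) ^ 2) + κ'))))
    (lam : J → ℝ) (hlam : ∀ j, |lam j| ≤ 2) :
    ∫⁻ x, ENNReal.ofReal (Real.exp (γ' * (m : ℝ) *
        ∑ j, b * (lam j * (((m : ℝ)⁻¹ * ∑ i, ballKernel ℓ (ys j) (x i)) - ρ₁ (ys j)) - lam j ^ 2 / 4))) ∂μ ≤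
      ENNReal.ofReal (Real.exp ((m : ℝ) * (2 * γ' * ML * ℓ + κ'))) := by
  have hm' : (0 : ℝ) < m := Nat.cast_pos.2 hm
  have hmne : (m : ℝ) ≠ 0 := hm'.ne'
  -- the tilt `w_j = b λ_j / 4` and its sup bound
  set w : J → ℝ := fun j => b / 4 * lam j with hw
  have hK0 : ∀ j x, 0 ≤ ballKernel ℓ (ys j) x := fun j x => ballKernel_nonneg ℓ _ _
  have hwsup : ∀ x, |∑ j, w j * ballKernel ℓ (ys j) x| ≤ 1 := by
    intro x
    calc |∑ j, w j * ballKernel ℓ (ys j) x| ≤ ∑ j, |w j * ballKernel ℓ (ys j) x| := Finset.abs_sum_le_sum_abs _ _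
      _ ≤ ∑ j, b / 2 * ballKernel ℓ (ys j) x := by
          refine Finset.sum_le_sum fun j _ => ?_
          rw [abs_mul, abs_of_nonneg (hK0 j x), hw]
          refine mul_le_mul_of_nonneg_right ?_ (hK0 j x)
          rw [abs_mul, abs_of_nonneg (by positivity : (0 : ℝ) ≤ b / 4)]
          calc b / 4 * |lam j| ≤ b / 4 * 2 := mul_le_mul_of_nonneg_left (hlam j) (by positivity)
            _ = b / 2 := by ring
      _ = (1 / 2) * ∑ j, b * ballKernel ℓ (ys j) x := by rw [Finset.mul_sum]; refine Finset.sum_congr rfl fun j _ => ?_; ring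
      _ ≤ (1 / 2) * Ā := mul_le_mul_of_nonneg_left (hĀ x) (by norm_num)
      _ ≤ 1 := by linarith
  -- the constant part of the exponent
  set E₀ : ℝ := ∑ j, -(γ' * (m : ℝ) * (b * (lam j * ρ₁ (ys j) + lam j ^ 2 / 4))) with hE₀
  have hswap : ∀ x : Fin m → T3, ∑ i, ∑ j, w j * ballKernel ℓ (ys j) (x i) =
      ∑ j, w j * ∑ i, ballKernel ℓ (ys j) (x i) := by
    intro x
    rw [Finset.sum_comm]
    exact Finset.sum_congr rfl fun j _ => by rw [Finset.mul_sum]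
  have hsplit : ∀ x : Fin m → T3,
      γ' * (m : ℝ) * ∑ j, b * (lam j * (((m : ℝ)⁻¹ * ∑ i, ballKernel ℓ (ys j) (x i)) - ρ₁ (ys j)) - lam j ^ 2 / 4) =
        E₀ + (4 * γ') * ∑ i, ∑ j, w j * ballKernel ℓ (ys j) (x i) := by
    intro x
    rw [hswap x, hE₀, Finset.mul_sum, Finset.mul_sum, ← Finset.sum_add_distrib]
    refine Finset.sum_congr rfl fun j _ => ?_
    simp only [hw]
    field_simp
    ring
  -- pull the constant out and apply the log-Laplace bound
  have hstep1 : ∫⁻ x, ENNReal.ofReal (Real.exp (γ' * (m : ℝ) *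
      ∑ j, b * (lam j * (((m : ℝ)⁻¹ * ∑ i, ballKernel ℓ (ys j) (x i)) - ρ₁ (ys j)) - lam j ^ 2 / 4))) ∂μ =
      ENNReal.ofReal (Real.exp E₀) *
        ∫⁻ x, ENNReal.ofReal (Real.exp ((4 * γ') * ∑ i, ∑ j, w j * ballKernel ℓ (ys j) (x i))) ∂μ := by
    rw [← lintegral_const_mul' _ _ ENNReal.ofReal_ne_top]
    refine lintegral_congr fun x => ?_
    rw [hsplit x, Real.exp_add, ENNReal.ofReal_mul (Real.exp_nonneg _)]
  rw [hstep1]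
  refine (mul_le_mul_right (hB w hwsup) _).trans ?_
  rw [← ENNReal.ofReal_mul (Real.exp_nonneg _), ← Real.exp_add]
  refine ENNReal.ofReal_le_ofReal (Real.exp_le_exp.2 ?_)
  -- the exponent: centring cancels up to the Lipschitz bias; the quadratic remainder is absorbed by the penalty
  have hlin : ∫ x, (∑ j, w j * ballKernel ℓ (ys j) x) * ρ₁ x = ∑ j, w j * ∫ x, ballKernel ℓ (ys j) x * ρ₁ x :=
    dl_integral_comb_mul ys w hρc
  have hbias : ∀ j, |ρ₁ (ys j) - ∫ x, ballKernel ℓ (ys j) x * ρ₁ x| ≤ ML * ℓ := fun j =>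
    dl_bias hℓ0 hℓ hρc hML hlip (ys j)
  have hquad : C₀ * (4 * γ') ^ 2 * ∫ x, (∑ j, w j * ballKernel ℓ (ys j) x) ^ 2 ≤
      γ' / 4 * ∑ j, b * lam j ^ 2 := by
    have hS := hSchur lam
    have hĀ0 : 0 ≤ Ā := by
      by_cases hJ : Nonempty J
      · obtain ⟨j⟩ := hJ
        exact le_trans (Finset.sum_nonneg fun i _ => mul_nonneg hb (hK0 i (ys j))) (hĀ (ys j))
      · have : (∑ _j : J, b) = 0 := by
          rw [Finset.sum_eq_zero]; intro j _; exact absurd ⟨j⟩ hJ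
        rw [this] at hbsum; exact absurd hbsum (by norm_num)
    have e1 : ∑ j, b / 4 * lam j ^ 2 = (1 / 4) * ∑ j, b * lam j ^ 2 := by
      rw [Finset.mul_sum]; exact Finset.sum_congr rfl fun j _ => by ring
    have hsum1 : 0 ≤ ∑ j, b * lam j ^ 2 := Finset.sum_nonneg fun j _ => by positivity
    have hw' : (fun x => (∑ j, w j * ballKernel ℓ (ys j) x) ^ 2) = fun x => (∑ j, b / 4 * lam j * ballKernel ℓ (ys j) x) ^ 2 := by
      funext x; simp only [hw]
    rw [hw']
    by_cases hC : 0 ≤ C₀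
    · calc C₀ * (4 * γ') ^ 2 * ∫ x, (∑ j, b / 4 * lam j * ballKernel ℓ (ys j) x) ^ 2
          ≤ C₀ * (4 * γ') ^ 2 * (Ā / 4 * ∑ j, b / 4 * lam j ^ 2) := mul_le_mul_of_nonneg_left hS (by positivity)
        _ = (C₀ * γ' * Ā) * (γ' * ∑ j, b * lam j ^ 2) := by rw [e1]; ring
        _ ≤ (1 / 4) * (γ' * ∑ j, b * lam j ^ 2) := mul_le_mul_of_nonneg_right hγC (mul_nonneg hγ'.le hsum1)
        _ = γ' / 4 * ∑ j, b * lam j ^ 2 := by ring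
    · have hneg : C₀ * (4 * γ') ^ 2 ≤ 0 := mul_nonpos_of_nonpos_of_nonneg (not_le.1 hC).le (by positivity)
      have hint0 : 0 ≤ ∫ x, (∑ j, b / 4 * lam j * ballKernel ℓ (ys j) x) ^ 2 := integral_nonneg fun x => sq_nonneg _
      calc C₀ * (4 * γ') ^ 2 * ∫ x, (∑ j, b / 4 * lam j * ballKernel ℓ (ys j) x) ^ 2 ≤ 0 :=
            mul_nonpos_of_nonpos_of_nonneg hneg hint0
        _ ≤ γ' / 4 * ∑ j, b * lam j ^ 2 := mul_nonneg (by positivity) hsum1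
  have hcentre : E₀ + (m : ℝ) * ((4 * γ') * (∫ x, (∑ j, w j * ballKernel ℓ (ys j) x) * ρ₁ x)) +
      (m : ℝ) * (γ' / 4 * ∑ j, b * lam j ^ 2) ≤ (m : ℝ) * (2 * γ' * ML * ℓ) := by
    rw [hlin, hE₀]
    -- everything is `γ' m Σ_j b λ_j (∫K_jρ₁ − ρ₁(y_j))`
    have e : (∑ j, -(γ' * (m : ℝ) * (b * (lam j * ρ₁ (ys j) + lam j ^ 2 / 4)))) +
        (m : ℝ) * ((4 * γ') * ∑ j, w j * ∫ x, ballKernel ℓ (ys j) x * ρ₁ x) +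
        (m : ℝ) * (γ' / 4 * ∑ j, b * lam j ^ 2) =
        γ' * (m : ℝ) * ∑ j, b * lam j * ((∫ x, ballKernel ℓ (ys j) x * ρ₁ x) - ρ₁ (ys j)) := by
      simp only [hw, Finset.mul_sum, ← Finset.sum_add_distrib]
      refine Finset.sum_congr rfl fun j _ => ?_; ring
    rw [e]
    have hbd : ∑ j, b * lam j * ((∫ x, ballKernel ℓ (ys j) x * ρ₁ x) - ρ₁ (ys j)) ≤ ∑ _j : J, b * 2 * (ML * ℓ) := by
      refine Finset.sum_le_sum fun j _ => ?_
      have h1 : |b * lam j * ((∫ x, ballKernel ℓ (ys j) x * ρ₁ x) - ρ₁ (ys j))| ≤ b * 2 * (ML * ℓ) := by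
        rw [abs_mul, abs_mul, abs_of_nonneg hb, abs_sub_comm]
        exact mul_le_mul (mul_le_mul_of_nonneg_left (hlam j) hb) (hbias j) (abs_nonneg _) (by positivity)
      exact (le_abs_self _).trans h1
    have hsum2 : ∑ _j : J, b * 2 * (ML * ℓ) = 2 * ML * ℓ := by
      rw [← Finset.sum_mul, ← Finset.sum_mul, hbsum]; ring
    calc γ' * (m : ℝ) * ∑ j, b * lam j * ((∫ x, ballKernel ℓ (ys j) x * ρ₁ x) - ρ₁ (ys j))
        ≤ γ' * (m : ℝ) * (2 * ML * ℓ) := mul_le_mul_of_nonneg_left (hbd.trans_eq hsum2) (by positivity)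
      _ = (m : ℝ) * (2 * γ' * ML * ℓ) := by ring
  have hm0 : (0 : ℝ) ≤ m := hm'.le
  have hq' := mul_le_mul_of_nonneg_left hquad hm0
  have e2 : E₀ + (m : ℝ) * ((4 * γ') * (∫ x, (∑ j, w j * ballKernel ℓ (ys j) x) * ρ₁ x) +
      C₀ * (4 * γ') ^ 2 * (∫ x, (∑ j, w j * ballKernel ℓ (ys j) x) ^ 2) + κ') =
      (E₀ + (m : ℝ) * ((4 * γ') * (∫ x, (∑ j, w j * ballKernel ℓ (ys j) x) * ρ₁ x))) +
        (m : ℝ) * (C₀ * (4 * γ') ^ 2 * ∫ x, (∑ j, w j * ballKernel ℓ (ys j) x) ^ 2) + (m : ℝ) * κ' := by ring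
  rw [e2]
  have e3 : (m : ℝ) * (2 * γ' * ML * ℓ + κ') = (m : ℝ) * (2 * γ' * ML * ℓ) + (m : ℝ) * κ' := by ring
  rw [e3]
  linarith

end Summit.AtomisticToContinuum.HydrodynamicLimit.Theorems.NearConstantShortTimeHL

end
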